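import Literature.NumberTheory.EllipticCurves.TwoDescentOneRootCubicField
import Mathlib.RingTheory.AdjoinRoot
import HarnessLib

/-!
# The generic `2`-descent over `L = F[X]/(Ψ₂/4)`: the rank bound for every elliptic curve with IRREDUCIBLE
# `2`-division cubic, modulo the arithmetic bound (Cassels, *Lectures on Elliptic Curves*, §15)

Topic `NumberTheory/EllipticCurves`; capstone of `TwoDescentOneRoot{,Kernel,Rank,CubicField}.lean`. Everything PROVED;
no named fact, no `sorry`, no definition (the monic `2`-division cubic
`Ψ₂/4 = X³ + (b₂/4)X² + (b₄/2)X + b₆/4` is written out in each statement).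

For an elliptic curve `E/F` (`char F = 0`) whose monic `2`-division cubic `f = Ψ₂/4` is irreducible over `F`, Cassels' ring
`F[Θ] = F[T]/(f)` IS the cubic field `L = AdjoinRoot f`, `Θ = AdjoinRoot.root f`:

* `isTwoTorsionX_root` — `Θ` is a root of `Ψ₂` of `E/L` (`AdjoinRoot.eval₂_root`);
* `finrank_adjoinRoot_twoDivision_eq_three`, `natDegree_minpoly_root_eq_three` — `[L : F] = 3`, `deg minpoly_F(Θ) = 3`;
* **`pow_mordellWeilRank_le_card_of_irreducible`** — if `E(F)` is finitely generated and the Cassels map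
  `μ : E(F) → Lˣ/Lˣ²`, `P ↦ x(P) − Θ`, takes values in a finite set `T`, then `2 ^ rank E(F) ≤ #T`;
  `ker_casselsMap_eq_of_irreducible` — `ker μ = 2E(F)` (Cassels §15 Lemmas 1–2 and the finite basis theorem, for
  the field case of footnote 13).

What remains for an unconditional rank certificate of a curve without rational `2`-torsion is the ARITHMETIC input `T`
(the square-norm classes of `L(S, 2)`, from the class group and units of the cubic field `L`).

## References

* [Cassels1991LecturesEllipticCurves] J. W. S. Cassels, *Lectures on Elliptic Curves*, LMSST 24 (1991), §15, pp. 42–44.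
-/

noncomputable section

open scoped Classical
open Polynomial

namespace WeierstrassCurve

open Affine Affine.Point

variable {F : Type*} [Field F] (V : WeierstrassCurve F)

/-- The monic `2`-division cubic has degree `3`. [cite: Cassels1991LecturesEllipticCurves, §15 (F(X) cubic)] -/
theorem natDegree_twoDivision_monic :
    (X ^ 3 + C (V.b₂ / 4) * X ^ 2 + C (V.b₄ / 2) * X + C (V.b₆ / 4) : F[X]).natDegree = 3 := by
  compute_degree!

/-- The monic `2`-division cubic is monic. [cite: Cassels1991LecturesEllipticCurves, §15 (F(X) cubic)] -/
theorem monic_twoDivision_monic :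
    (X ^ 3 + C (V.b₂ / 4) * X ^ 2 + C (V.b₄ / 2) * X + C (V.b₆ / 4) : F[X]).Monic := by
  unfold Monic leadingCoeff
  rw [natDegree_twoDivision_monic]
  simp [coeff_X_pow]

variable [Fact (Irreducible (X ^ 3 + C (V.b₂ / 4) * X ^ 2 + C (V.b₄ / 2) * X + C (V.b₆ / 4) : F[X]))]

/-- **`Θ = root f` is a root of `Ψ₂` over `L = F[X]/(f)`**, `f = Ψ₂/4` (Cassels' `Θ`, the image of `T` in `F[T]/F(T)`).
[cite: Cassels1991LecturesEllipticCurves, §15 (definition of Θ)] -/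
theorem isTwoTorsionX_root [CharZero F] :
    (V.baseChange (AdjoinRoot (X ^ 3 + C (V.b₂ / 4) * X ^ 2 + C (V.b₄ / 2) * X + C (V.b₆ / 4) : F[X]))).toAffine.IsTwoTorsionX
      (AdjoinRoot.root (X ^ 3 + C (V.b₂ / 4) * X ^ 2 + C (V.b₄ / 2) * X + C (V.b₆ / 4) : F[X])) := by
  set f : F[X] := X ^ 3 + C (V.b₂ / 4) * X ^ 2 + C (V.b₄ / 2) * X + C (V.b₆ / 4) with hf
  haveI : CharZero (AdjoinRoot f) :=
    charZero_of_injective_algebraMap (algebraMap F (AdjoinRoot f)).injective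
  have h := AdjoinRoot.eval₂_root f
  rw [hf, ← AdjoinRoot.algebraMap_eq] at h
  simp only [eval₂_add, eval₂_mul, eval₂_pow, eval₂_X, eval₂_C, map_div₀] at h
  refine ⟨?_⟩
  have hb2 : (V.baseChange (AdjoinRoot f)).toAffine.b₂ = algebraMap F (AdjoinRoot f) V.b₂ := V.map_b₂ _
  have hb4 : (V.baseChange (AdjoinRoot f)).toAffine.b₄ = algebraMap F (AdjoinRoot f) V.b₄ := V.map_b₄ _
  have hb6 : (V.baseChange (AdjoinRoot f)).toAffine.b₆ = algebraMap F (AdjoinRoot f) V.b₆ := V.map_b₆ _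
  rw [hb2, hb4, hb6]
  have h4 : (algebraMap F (AdjoinRoot f)) 4 = 4 := map_ofNat _ 4
  have h2 : (algebraMap F (AdjoinRoot f)) 2 = 2 := map_ofNat _ 2
  rw [h4, h2] at h
  linear_combination (4 : AdjoinRoot f) * h

/-- `[L : F] = 3` for `L = F[X]/(Ψ₂/4)`. [cite: Cassels1991LecturesEllipticCurves, §15 (ℚ[Θ] of dimension 3)] -/
theorem finrank_adjoinRoot_twoDivision_eq_three :
    Module.finrank F (AdjoinRoot (X ^ 3 + C (V.b₂ / 4) * X ^ 2 + C (V.b₄ / 2) * X + C (V.b₆ / 4) : F[X])) = 3 := by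
  rw [(AdjoinRoot.powerBasis (monic_twoDivision_monic V).ne_zero).finrank, AdjoinRoot.powerBasis_dim,
    natDegree_twoDivision_monic]

/-- `deg minpoly_F(Θ) = 3` for `Θ = root (Ψ₂/4)` (`f` monic irreducible, so `minpoly Θ = f`).
[cite: Cassels1991LecturesEllipticCurves, §15 (F irreducible)] -/
theorem natDegree_minpoly_root_eq_three :
    (minpoly F (AdjoinRoot.root (X ^ 3 + C (V.b₂ / 4) * X ^ 2 + C (V.b₄ / 2) * X + C (V.b₆ / 4) : F[X]))).natDegree = 3 := by
  rw [AdjoinRoot.minpoly_root (monic_twoDivision_monic V).ne_zero, (monic_twoDivision_monic V).leadingCoeff, inv_one,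
    map_one, mul_one, natDegree_twoDivision_monic]

variable [CharZero F] [V.IsElliptic]
  [CharZero (AdjoinRoot (X ^ 3 + C (V.b₂ / 4) * X ^ 2 + C (V.b₄ / 2) * X + C (V.b₆ / 4) : F[X]))]
  [(V.baseChange (AdjoinRoot (X ^ 3 + C (V.b₂ / 4) * X ^ 2 + C (V.b₄ / 2) * X + C (V.b₆ / 4) : F[X]))).IsElliptic]

/-- **`ker μ = 2E(F)`** for the Cassels map of `E/F` into `Lˣ/Lˣ²`, `L = F[X]/(Ψ₂/4)` with `Ψ₂/4` irreducible
(Cassels §15 Lemma 2, field case). The instance hypotheses `CharZero L`, `(E_L).IsElliptic` hold always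
(`charZero_of_injective_algebraMap`, `inferInstance`). [cite: Cassels1991LecturesEllipticCurves, §15 Lemma 2] -/
theorem ker_casselsMap_eq_of_irreducible :
    (casselsMap (V := V) (AdjoinRoot (X ^ 3 + C (V.b₂ / 4) * X ^ 2 + C (V.b₄ / 2) * X + C (V.b₆ / 4) : F[X]))
        (isTwoTorsionX_root V)).ker =
      (nsmulAddMonoidHom 2 : V.toAffine.Point →+ V.toAffine.Point).range := by
  haveI := (AdjoinRoot.powerBasis (monic_twoDivision_monic V).ne_zero).finite
  exact ker_casselsMap_eq_of_finrank_eq_three V _ (finrank_adjoinRoot_twoDivision_eq_three V)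
    (isTwoTorsionX_root V) (natDegree_minpoly_root_eq_three V)

/-- **The generic `2`-descent rank bound for every elliptic curve with irreducible `2`-division cubic** (Cassels §15):
with `L = F[X]/(Ψ₂/4)`, `Θ = root`, if `E(F)` is finitely generated and the Cassels map `P ↦ x(P) − Θ ∈ Lˣ/Lˣ²` takes values
in a finite set `T`, then `2 ^ rank E(F) ≤ #T`. [cite: Cassels1991LecturesEllipticCurves, §15 Theorem (finite basis) with Lemmas 1–2] -/
theorem pow_mordellWeilRank_le_card_of_irreducible [Module.Finite ℤ V.toAffine.Point]
    (T : Finset (Additive (SqUnits (AdjoinRoot (X ^ 3 + C (V.b₂ / 4) * X ^ 2 + C (V.b₄ / 2) * X + C (V.b₆ / 4) : F[X])))))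
    (hT : ∀ P : V.toAffine.Point,
      casselsMap (V := V) (AdjoinRoot (X ^ 3 + C (V.b₂ / 4) * X ^ 2 + C (V.b₄ / 2) * X + C (V.b₆ / 4) : F[X]))
        (isTwoTorsionX_root V) P ∈ T) :
    2 ^ V.mordellWeilRank ≤ T.card := by
  haveI := (AdjoinRoot.powerBasis (monic_twoDivision_monic V).ne_zero).finite
  exact pow_mordellWeilRank_le_card_of_finrank_eq_three V _ (finrank_adjoinRoot_twoDivision_eq_three V)
    (isTwoTorsionX_root V) (natDegree_minpoly_root_eq_three V) T hT

end WeierstrassCurve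

end
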